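import Literature.NumberTheory.IwasawaTheory.NarrowFukudaCertificateLayerTwoModel
import HarnessLib

/-!
# Fukuda's index is `≤ 1` for the cyclotomic `ℤ₂`-extension of an odd-degree number field in which no prime above `2` has `4 ∣ e` —
# in particular for EVERY cubic field; the narrow rank certificate at the rung `n = 1` with NO ramification hypothesis

Topic `NumberTheory/IwasawaTheory` (namespace = path). THEOREM-ONLY file (no definition, no named fact, no `sorry`), written by the prover seat
`cruxlead-stmt-BirchSwinnertonDyer-19573-w2` GEN 10 (cell `bsd-2adic`; `--supports` stmt-BirchSwinnertonDyer-19573; closes nothing).  Sequel of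
`ZpExtensionTotallyRamifiedFromLayerOne.lean` (index `0` ⟸ ramification in `K_1`), `CyclotomicTwoTotallyRamifiedOddIndex.lean` (odd `e(w|2)` ⟹ index `0`)
and `NarrowFukudaCertificateLayerTwoModel.lean` (this seat: `K_2 ∋ √(2+√2)`, the `n = 1` certificate `NarrowFukuda.narrowMu_of_layerTwo_model`).

THE POINT.  Fukuda's standing hypothesis `TotallyRamifiedFrom κ n₀` with `n₀ = 1` says: every prime ramified in `K_∞/K` is totally ramified in
`K_∞/K_1`.  In a `ℤ_p`-extension the image `κ(I_𝔓) ⊆ ℤ_p` of an inertia group is `0` or `p^aℤ_p`; it contains `pℤ_p = Gal(K_∞/K_1)` iff `a ≤ 1`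
iff `I_𝔓 ⊄ p²ℤ_p = Gal(K̄/K_2)`, i.e. iff the prime is RAMIFIED IN THE SECOND LAYER `K_2` (§1, the index-`m` form of Washington's proof of Lemma 13.3).
At `p = 2` with `2 ∤ [K:ℚ]`, `K_2 = K·ℚ(ζ₁₆)⁺` contains a root `θ` of `X⁴ − 4X² + 2`, and `θ⁴ = 2·(2θ² − 1)` with `2θ² − 1` a UNIT
(`(2θ² − 1)(7 − 2θ²) = 1`), so `2𝓞 = (θ)⁴` and `4 ∣ e(Q|2)` for every prime `Q ∣ 2` of `K_2` (§2); hence a place `w ∣ 2` of `K` with `4 ∤ e(w|2)` is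
ramified in `K_2` (`e(Q|2) = e(w|2)·e(Q|w)`).  So (§3) **`4 ∤ e(w|2)` for all `w ∣ 2` ⟹ `TotallyRamifiedFrom κ 1`** for every cyclotomic `ℤ₂`-extension
of `K` — and for a CUBIC field `e(w|2) ≤ 3` always (§3, `forall_totallyRamifiedFrom_one_of_finrank_eq_three`): the index is `≤ 1` with NO hypothesis.
Consequently (§4) the `n = 1` narrow rank certificate of NARROW FUKUDA needs, for a cubic field, NOTHING but the ONE equality
`rank₂ Cl⁺(K(√(2+√2))) = rank₂ Cl⁺(K(√2))` (`NarrowFukuda.narrowMu_of_layerTwo_model_of_finrank_eq_three`).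

* §1 `layerSubgroup_le_of_layerSubgroup_le_of_not_pow_dvd` (a subgroup containing `κ⁻¹(p^eℤ_p)` and some `g` with `p^{m+1} ∤ κ g` contains
  `κ⁻¹(p^mℤ_p)`), **`totallyRamifiedFrom_of_forall_not_le_layerSubgroup_succ`**, **`totallyRamifiedFrom_of_forall_not_isUnramifiedIn_layer_succ`**
  (index `m` ⟸ every `w ∣ p` ramified in `K_{m+1}`) — any `p`, any `ℤ_p`-extension.
* §2 `four_dvd_ramificationIdx_int_of_quartic_root` (`θ⁴ − 4θ² + 2 = 0` in `L` ⟹ `4 ∣ e(Q|2)` for every `Q ∣ 2` of `L`).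
* §3 `not_isUnramifiedIn_layer_two_of_not_four_dvd_ramificationIdx`, **`totallyRamifiedFrom_one_of_forall_not_four_dvd_ramificationIdx`**,
  `ramificationIdx_int_le_finrank` (`e(w|2) ≤ [K:ℚ]`), **`forall_totallyRamifiedFrom_one_of_finrank_eq_three`** (cubic fields: index `≤ 1`, unconditional).
* §4 **`NarrowFukuda.narrowMu_of_layerTwo_model_of_forall_not_four_dvd`**, **`NarrowFukuda.narrowMu_of_layerTwo_model_of_finrank_eq_three`** —
  for a cubic field `K` and models `L₁ ≅ K(√2)` (degree `2`, `θ₁² = 2`), `L₂ ≅ K(√(2+√2))` (degree `4`, `θ₂⁴ − 4θ₂² + 2 = 0`):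
  `[Cl⁺(L₂) : Cl⁺(L₂)²] = [Cl⁺(L₁) : Cl⁺(L₁)²]` ALONE ⟹ (a) `μ₂ = 0` for every cyclotomic `ℤ₂`-extension of `K` ∧ (b) bounded narrow defect.

Honest scope: classical statements (no elliptic curve); nothing is asserted about any field's class groups.  BSD is not proved by any of this.

References: [Washington1997] §13.1, Prop. 13.2, proof of Lemma 13.3 (`κ(I) = p^aℤ_p`); [Fukuda1994] p. 264 (the index `n₀`), Thm. 1 (2);
[NeukirchANT1999] Ch. I §8 (multiplicativity of `e`; `Σ eᵢfᵢ = n`), Ch. VII §10.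
-/

set_option autoImplicit false

noncomputable section

open scoped NumberField Pointwise
open Multiplicative Polynomial UniqueFactorizationMonoid

namespace Literature.NumberTheory.IwasawaTheory

open Literature.NumberTheory.EllipticCurves Literature.NumberTheory.GaloisRepresentations Field
  IsDedekindDomain NumberField Literature.NumberTheory.NumberFields

/-! ## §1 Index `m`: `κ(I_𝔓) ⊄ p^{m+1}ℤ_p` forces `κ(I_𝔓) ⊇ p^m ℤ_p` (any `p`, any `ℤ_p`-extension) -/

section Abstract

variable {K : Type} [Field K] [NumberField K] {p : ℕ} [Fact p.Prime]

omit [NumberField K] in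
/-- **A subgroup `H ≤ Γ_K` containing `Gal(K̄/K_e) = κ⁻¹(p^e ℤ_p)` and some `g` with `p^{m+1} ∤ κ g` contains `Gal(K̄/K_m) = κ⁻¹(p^m ℤ_p)`**:
`κ g = p^v u` with `v ≤ m` and `u` a unit of `ℤ_p`, so for `σ` with `p^m ∣ κ σ` there is `n ∈ ℕ` with `κ σ ≡ n κ g (mod p^{e+v})`, whence
`σ = g^n · (g^{-n} σ)` with `g^{-n}σ ∈ κ⁻¹(p^eℤ_p) ≤ H`.  (The case `m = 0` is `eq_top_of_layerSubgroup_le_of_not_dvd`.)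
[cite: Washington1997, §13.1 (proof of Lemma 13.3)] -/
theorem layerSubgroup_le_of_layerSubgroup_le_of_not_pow_dvd (κ : ZpExtension K p) {H : Subgroup (absoluteGaloisGroup K)}
    {e m : ℕ} (he : κ.layerSubgroup e ≤ H) {g : absoluteGaloisGroup K} (hg : g ∈ H)
    (hndvd : ¬ (p : ℤ_[p]) ^ (m + 1) ∣ toAdd (κ g)) : κ.layerSubgroup m ≤ H := by
  classical
  intro σ hσ
  set x : ℤ_[p] := toAdd (κ g) with hx
  have hx0 : x ≠ 0 := fun h0 => hndvd (by rw [h0]; exact dvd_zero _)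
  -- `x = u p^v` with `v ≤ m`
  set v : ℕ := x.valuation with hv
  have hvm : v ≤ m := by
    by_contra hlt
    apply hndvd
    rw [← Ideal.mem_span_singleton, PadicInt.mem_span_pow_iff_le_valuation x hx0]
    omega
  set u : ℤ_[p]ˣ := PadicInt.unitCoeff hx0 with hu
  have hxu : x = (u : ℤ_[p]) * (p : ℤ_[p]) ^ v := PadicInt.unitCoeff_spec hx0
  -- `κ σ = p^m c = p^v (p^{m-v} c)`
  rw [ZpExtension.mem_layerSubgroup] at hσ
  obtain ⟨c, hc⟩ := hσ
  set z : ℤ_[p] := (p : ℤ_[p]) ^ (m - v) * c * ((u⁻¹ : ℤ_[p]ˣ) : ℤ_[p]) with hz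
  -- choose `n` with `z ≡ n (mod p^e)`
  set n : ℕ := (PadicInt.toZModPow e z).val with hn
  have hmod : (p : ℤ_[p]) ^ e ∣ z - (n : ℤ_[p]) := by
    rw [← Ideal.mem_span_singleton, ← PadicInt.ker_toZModPow, RingHom.mem_ker, map_sub, map_natCast, hn,
      ZMod.natCast_zmod_val, sub_self]
  -- `κ σ − n κ g = p^v u (z − n)`
  have hkey : toAdd (κ σ) - (n : ℤ_[p]) * x = (p : ℤ_[p]) ^ v * (u : ℤ_[p]) * (z - (n : ℤ_[p])) := by
    have hm : (p : ℤ_[p]) ^ m = (p : ℤ_[p]) ^ v * (p : ℤ_[p]) ^ (m - v) := by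
      rw [← pow_add, Nat.add_sub_cancel' hvm]
    rw [hc, hxu, hz, hm]
    have huu : (u : ℤ_[p]) * ((u⁻¹ : ℤ_[p]ˣ) : ℤ_[p]) = 1 := Units.mul_inv u
    linear_combination (-((p : ℤ_[p]) ^ v * (p : ℤ_[p]) ^ (m - v) * c)) * huu
  have hmem : (g ^ n)⁻¹ * σ ∈ κ.layerSubgroup e := by
    rw [ZpExtension.mem_layerSubgroup, map_mul, map_inv, map_pow, toAdd_mul, toAdd_inv, toAdd_pow, nsmul_eq_mul]
    have : -((n : ℤ_[p]) * x) + toAdd (κ σ) = toAdd (κ σ) - (n : ℤ_[p]) * x := by ring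
    rw [this, hkey]
    exact hmod.mul_left _
  have hσeq : σ = g ^ n * ((g ^ n)⁻¹ * σ) := by group
  rw [hσeq]
  exact H.mul_mem (H.pow_mem hg n) (he hmem)

/-- **Abstract criterion for Fukuda's index `m`.**  If every prime `𝔓` of `\bar ℤ_K` (above a finite place) either has `I_𝔓 ≤ Gal(K̄/K_∞)` (unramified in
the tower) or `I_𝔓 ≰ Gal(K̄/K_{m+1}) = κ⁻¹(p^{m+1}ℤ_p)` (does not fix the layer `K_{m+1}`), then every ramified prime is totally ramified in `K_∞/K_m`:
`TotallyRamifiedFrom κ m` (`κ(I_𝔓)` is closed, hence `⊇ p^e ℤ_p` for some `e`, tree `inertia_le_kerSubgroup_or_exists_layerSubgroup_le`; with an element of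
valuation `≤ m` it contains `p^mℤ_p`, §1). The case `m = 0` is `totallyRamifiedFrom_zero_of_forall_not_le_layerSubgroup_one`.
[cite: Washington1997, §13.1 (proof of Lemma 13.3)] [cite: Fukuda1994, p. 264] -/
theorem totallyRamifiedFrom_of_forall_not_le_layerSubgroup_succ (κ : ZpExtension K p) (m : ℕ)
    (h : ∀ (w : HeightOneSpectrum (𝓞 K)) (𝔓 : Ideal (absIntegers (𝓞 K) K)), 𝔓 ∈ w.primesAbove →
      𝔓.inertia (absoluteGaloisGroup K) ≤ κ.kerSubgroup ∨
        ¬ 𝔓.inertia (absoluteGaloisGroup K) ≤ κ.layerSubgroup (m + 1)) :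
    TotallyRamifiedFrom κ m := by
  rw [totallyRamifiedFrom_iff]
  intro w 𝔓 h𝔓
  rcases h w 𝔓 h𝔓 with hle | hnot
  · exact Or.inl hle
  · right
    rcases inertia_le_kerSubgroup_or_exists_layerSubgroup_le κ 𝔓 with hle | ⟨e, he⟩
    · exact absurd (hle.trans (κ.kerSubgroup_le_layerSubgroup (m + 1))) hnot
    · obtain ⟨g, hgI, hg1⟩ := SetLike.not_le_iff_exists.mp hnot
      rw [ZpExtension.mem_layerSubgroup] at hg1
      exact layerSubgroup_le_of_layerSubgroup_le_of_not_pow_dvd κ he (Subgroup.mem_sup_left hgI) hg1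

/-- **Fukuda's index is `m` when every prime above `p` is ramified in the layer `K_{m+1}`.**  For a `ℤ_p`-extension `κ` of a number field `K`: if
every place `w ∣ p` of `K` is RAMIFIED in `K_{m+1} = κ.layer (m+1)` (`¬ Algebra.IsUnramifiedIn (𝓞 K_{m+1}) w`), then every prime of `\bar ℤ_K` is
unramified in `K_∞/K` or totally ramified in `K_∞/K_m` — `TotallyRamifiedFrom κ m` (places `w ∤ p` are unramified in the tower, tree
`ZpExtension.inertia_le_kerSubgroup_holds`, Washington Prop. 13.2; ramification in a layer ⟺ some inertia group does not fix it, tree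
`isUnramifiedIn_layer_iff_inertia_le`).  The case `m = 0` is `totallyRamifiedFrom_zero_of_forall_not_isUnramifiedIn_layer_one`.
[cite: Washington1997, §13.1 Prop. 13.2 and Lemma 13.3 (proof)] [cite: Fukuda1994, p. 264] -/
theorem totallyRamifiedFrom_of_forall_not_isUnramifiedIn_layer_succ (κ : ZpExtension K p) (m : ℕ)
    (h : ∀ w : HeightOneSpectrum (𝓞 K), ((p : ℕ) : 𝓞 K) ∈ w.asIdeal →
      ¬ Algebra.IsUnramifiedIn (𝓞 (κ.layer (m + 1))) w.asIdeal) :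
    TotallyRamifiedFrom κ m := by
  refine totallyRamifiedFrom_of_forall_not_le_layerSubgroup_succ κ m fun w 𝔓 h𝔓 => ?_
  by_cases hpw : ((p : ℕ) : 𝓞 K) ∈ w.asIdeal
  · exact Or.inr fun hle => h w hpw ((isUnramifiedIn_layer_iff_inertia_le κ (m + 1) h𝔓).mpr hle)
  · exact Or.inl (ZpExtension.inertia_le_kerSubgroup_holds K p κ hpw h𝔓)

end Abstract

/-! ## §2 A root of `X⁴ − 4X² + 2` forces `4 ∣ e(Q|2)` -/

section Quartic

variable {L : Type*} [Field L] [NumberField L]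

omit [NumberField L] in
/-- A root of `X⁴ − 4X² + 2` in a number field is an algebraic integer. [folklore] -/
private theorem isIntegral_int_of_quartic_root {θ : L} (hθ : θ ^ 4 - 4 * θ ^ 2 + 2 = 0) : IsIntegral ℤ θ := by
  refine ⟨X ^ 4 - C 4 * X ^ 2 + C 2, by monicity!, ?_⟩
  simp only [eval₂_add, eval₂_sub, eval₂_mul, eval₂_X_pow, eval₂_ofNat, map_ofNat]
  linear_combination hθ

/-- **`4 ∣ e(Q|2)` when `L ∋ √(2+√2)`.**  If `θ⁴ − 4θ² + 2 = 0` in the number field `L`, then for every prime `Q` of `𝓞 L` above `2` the ramification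
index `e(Q|2)` is divisible by `4`: `θ⁴ = 2(2θ² − 1)` with `(2θ² − 1)(7 − 2θ²) = 1`, so `2𝓞_L = (θ)⁴` and the exponent of `Q` in `2𝓞_L` is four times
that in `(θ)` (Mathlib `Ideal.IsDedekindDomain.ramificationIdx_eq_normalizedFactors_count`).  (`ℚ(√(2+√2)) = ℚ(ζ₁₆)⁺` is totally ramified at `2`
of degree `4`.) [cite: Washington1997, §13.1 and Prop. 13.2 (total ramification of `2` in `ℚ_n`)] [cite: NeukirchANT1999, Ch. I §8] -/
theorem four_dvd_ramificationIdx_int_of_quartic_root {θ : L} (hθ : θ ^ 4 - 4 * θ ^ 2 + 2 = 0) (Q : Ideal (𝓞 L))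
    [Q.IsPrime] [Q.LiesOver (Ideal.span {(2 : ℤ)})] : 4 ∣ Q.ramificationIdx ℤ := by
  classical
  set θ' : 𝓞 L := ⟨θ, isIntegral_int_of_quartic_root hθ⟩ with hθ'
  -- the unit `w = 2θ² − 1` with inverse `7 − 2θ²`
  have hw : (2 * θ' ^ 2 - 1) * (7 - 2 * θ' ^ 2) = 1 := by
    apply Subtype.ext
    change (((2 * θ' ^ 2 - 1) * (7 - 2 * θ' ^ 2) : 𝓞 L) : L) = ((1 : 𝓞 L) : L)
    push_cast
    change (2 * θ ^ 2 - 1) * (7 - 2 * θ ^ 2) = 1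
    linear_combination (-4 : L) * hθ
  have hunit : IsUnit (2 * θ' ^ 2 - 1 : 𝓞 L) := isUnit_iff_exists_inv.mpr ⟨_, hw⟩
  have hθ4 : θ' ^ 4 = 2 * (2 * θ' ^ 2 - 1) := by
    apply Subtype.ext
    change ((θ' ^ 4 : 𝓞 L) : L) = ((2 * (2 * θ' ^ 2 - 1) : 𝓞 L) : L)
    push_cast
    change θ ^ 4 = 2 * (2 * θ ^ 2 - 1)
    linear_combination hθ
  have hspan : Ideal.span {(2 : 𝓞 L)} = Ideal.span {θ'} ^ 4 := by
    rw [Ideal.span_singleton_pow, hθ4, Ideal.span_singleton_mul_right_unit hunit]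
  have hmap : Ideal.map (algebraMap ℤ (𝓞 L)) (Ideal.span {(2 : ℤ)}) = Ideal.span {θ'} ^ 4 := by
    rw [Ideal.map_span, Set.image_singleton, map_ofNat, hspan]
  have hp0 : Ideal.map (algebraMap ℤ (𝓞 L)) (Ideal.span {(2 : ℤ)}) ≠ ⊥ :=
    Ideal.map_ne_bot_of_ne_bot (by simp)
  rw [Ideal.IsDedekindDomain.ramificationIdx_eq_normalizedFactors_count (Ideal.span {(2 : ℤ)}) Q hp0,
    hmap, normalizedFactors_pow, Multiset.count_nsmul]
  exact dvd_mul_right 4 _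

end Quartic

/-! ## §3 `4 ∤ e(w|2)` forces ramification of `w` in `K₂`, hence Fukuda's index `≤ 1`; cubic fields -/

section IndexOne

variable {K : Type} [Field K] [NumberField K]

omit [NumberField K] in
/-- A place of `K` containing `2` lies over `(2) ⊂ ℤ`. [folklore] -/
private theorem liesOver_span_two_of_mem' (w : HeightOneSpectrum (𝓞 K)) (hw : ((2 : ℕ) : 𝓞 K) ∈ w.asIdeal) :
    w.asIdeal.LiesOver (Ideal.span {(2 : ℤ)}) := by
  rw [Ideal.liesOver_span_iff w.isPrime.ne_top Int.prime_two, map_ofNat]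
  exact_mod_cast hw

/-- **`4 ∤ e(w|2)` ⟹ `w` ramifies in `K₂ = K(√(2+√2))`.**  For a number field `K` with `2 ∤ [K:ℚ]`, a cyclotomic `ℤ₂`-extension `κ` of `K` and a
place `w ∣ 2` of `K` whose ramification index `e(w|2)` over `ℤ` is NOT divisible by `4`, the place `w` is ramified in the second layer
`K₂ = κ.layer 2`: for a prime `Q ∣ w` of `𝓞 K₂`, `e(Q|2) = e(w|2)·e(Q|w)` (Mathlib `Ideal.ramificationIdx_tower`) is divisible by `4` (§2, `K₂ ∋ √(2+√2)`
by `exists_quartic_root_layer_two_of_not_dvd_finrank`), so `e(Q|w) ≠ 1`. [cite: Washington1997, §13.1] [cite: NeukirchANT1999, Ch. I §8] -/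
theorem not_isUnramifiedIn_layer_two_of_not_four_dvd_ramificationIdx (hK : ¬ 2 ∣ Module.finrank ℚ K)
    (κ : ZpExtension K 2) (hκ : κ.IsCyclotomic) {w : HeightOneSpectrum (𝓞 K)}
    (hw : ((2 : ℕ) : 𝓞 K) ∈ w.asIdeal) (h4 : ¬ 4 ∣ w.asIdeal.ramificationIdx ℤ) :
    ¬ Algebra.IsUnramifiedIn (𝓞 (κ.layer 2)) w.asIdeal := by
  haveI : Fact (Nat.Prime 2) := ⟨Nat.prime_two⟩
  haveI : FiniteDimensional K (κ.layer 2) := κ.finiteDimensional_layer_holds 2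
  haveI : NumberField (κ.layer 2) := NumberField.of_module_finite K _
  intro hunr
  obtain ⟨θ, hθ⟩ := exists_quartic_root_layer_two_of_not_dvd_finrank hK κ hκ
  haveI : w.asIdeal.IsPrime := w.isPrime
  haveI := liesOver_span_two_of_mem' w hw
  obtain ⟨⟨Q, hQprime, hQover⟩⟩ :=
    (inferInstance : Nonempty (Ideal.primesOver w.asIdeal (𝓞 (κ.layer 2))))
  haveI := hQprime
  haveI := hQover
  haveI : Q.LiesOver (Ideal.span {(2 : ℤ)}) := Ideal.LiesOver.trans Q w.asIdeal _
  have h1 : Q.ramificationIdx (𝓞 K) = 1 := hunr.ramificationIdx_eq_one hQover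
  have hfour := four_dvd_ramificationIdx_int_of_quartic_root hθ Q
  rw [Ideal.ramificationIdx_tower w.asIdeal Q, h1, mul_one] at hfour
  exact h4 hfour

/-- **Fukuda's index is `≤ 1` when no prime above `2` has `4 ∣ e`.**  For a number field `K` with `2 ∤ [K:ℚ]` and a cyclotomic `ℤ₂`-extension `κ` of
`K`: if every place `w ∣ 2` of `K` has `4 ∤ e(w|2)`, then every prime ramified in `K_∞/K` is totally ramified in `K_∞/K₁` — `TotallyRamifiedFrom κ 1`
(every `w ∣ 2` is ramified in `K₂`, then §1).  Covers every cubic field and every odd-degree field with all `e(w|2) ∈ {1, 2, 3, 5, 6, 7, 9, …}`.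
[cite: Washington1997, §13.1 Lemma 13.3 (proof)] [cite: Fukuda1994, p. 264] -/
theorem totallyRamifiedFrom_one_of_forall_not_four_dvd_ramificationIdx (hK : ¬ 2 ∣ Module.finrank ℚ K)
    (κ : ZpExtension K 2) (hκ : κ.IsCyclotomic)
    (h4 : ∀ w : HeightOneSpectrum (𝓞 K), ((2 : ℕ) : 𝓞 K) ∈ w.asIdeal → ¬ 4 ∣ w.asIdeal.ramificationIdx ℤ) :
    TotallyRamifiedFrom κ 1 :=
  haveI : Fact (Nat.Prime 2) := ⟨Nat.prime_two⟩
  totallyRamifiedFrom_of_forall_not_isUnramifiedIn_layer_succ κ 1 fun w hw =>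
    not_isUnramifiedIn_layer_two_of_not_four_dvd_ramificationIdx hK κ hκ hw (h4 w hw)

/-- **`e(w|2) ≤ [K:ℚ]`** for a place `w ∣ 2` of a number field `K` (the fundamental identity `Σ eᵢfᵢ = [K:ℚ]`, Mathlib `Ideal.ramificationIdx_le_finrank`).
[cite: NeukirchANT1999, Ch. I §8 Prop. (8.2)] -/
theorem ramificationIdx_int_le_finrank {w : HeightOneSpectrum (𝓞 K)} (hw : ((2 : ℕ) : 𝓞 K) ∈ w.asIdeal) :
    w.asIdeal.ramificationIdx ℤ ≤ Module.finrank ℚ K := by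
  haveI : w.asIdeal.IsPrime := w.isPrime
  haveI := liesOver_span_two_of_mem' w hw
  haveI : (Ideal.span {(2 : ℤ)}).IsMaximal :=
    ((Ideal.span_singleton_prime two_ne_zero).mpr Int.prime_two).isMaximal (by simp)
  rw [← Ideal.ramificationIdx'_eq_ramificationIdx (Ideal.span {(2 : ℤ)}) w.asIdeal (by simp)]
  exact Ideal.ramificationIdx_le_finrank (𝓞 K) ℚ K w.asIdeal

/-- **Cubic fields have Fukuda index `≤ 1` — unconditionally.**  For a number field `K` with `[K:ℚ] = 3` and every cyclotomic `ℤ₂`-extension `κ` of `K`: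
`TotallyRamifiedFrom κ 1` (`e(w|2) ≤ 3 < 4` for every `w ∣ 2`). [cite: Washington1997, §13.1 Lemma 13.3 (proof)] [cite: Fukuda1994, p. 264] -/
theorem forall_totallyRamifiedFrom_one_of_finrank_eq_three (h3 : Module.finrank ℚ K = 3) :
    ∀ κ : ZpExtension K 2, κ.IsCyclotomic → TotallyRamifiedFrom κ 1 := by
  intro κ hκ
  refine totallyRamifiedFrom_one_of_forall_not_four_dvd_ramificationIdx (by rw [h3]; decide) κ hκ fun w hw hdvd => ?_
  have hle := ramificationIdx_int_le_finrank (K := K) hw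
  rw [h3] at hle
  haveI : Fact (Nat.Prime 2) := ⟨Nat.prime_two⟩
  haveI : w.asIdeal.IsPrime := w.isPrime
  have hpos : 0 < w.asIdeal.ramificationIdx ℤ := Ideal.ramificationIdx_pos w.asIdeal ℤ
  exact absurd (Nat.le_of_dvd hpos hdvd) (by omega)

end IndexOne

/-! ## §4 The `n = 1` narrow rank certificate without ramification hypothesis -/

/-- **«Narrow `μ₂ = 0`» of an odd-degree number field with all `4 ∤ e(w|2)` from ONE equality `rank₂ Cl⁺(K_2) = rank₂ Cl⁺(K_1)`.**  `K` of odd degree,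
every place `w ∣ 2` with `4 ∤ e(w|2)` (so Fukuda's index is `≤ 1`, §3); `L₁/K` a quadratic extension with `θ₁² = 2` (a model of `K_1 = K(√2)`),
`L₂/K` of degree `4` with `θ₂⁴ − 4θ₂² + 2 = 0` (a model of `K_2 = K(√(2+√2))`), `[Cl⁺(L₂) : Cl⁺(L₂)²] = [Cl⁺(L₁) : Cl⁺(L₁)²]` ⟹ (a) `μ₂ = 0` for every
cyclotomic `ℤ₂`-extension of `K` ∧ (b) `ord₂ h⁺(K_m) ≤ ord₂ h(K_m) + max (ord₂[Cl⁺(K):Cl⁺(K)²]) (ord₂[Cl⁺(L₁):Cl⁺(L₁)²])` for every layer.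
`NarrowFukuda.narrowMu_of_layerTwo_model` + §3. [cite: Fukuda1994, Thm. 1 (2), p. 264] [cite: Washington1997, §13.1] -/
theorem NarrowFukuda.narrowMu_of_layerTwo_model_of_forall_not_four_dvd (K : Type) [Field K] [NumberField K]
    (hodd : Odd (Module.finrank ℚ K))
    (h4 : ∀ w : HeightOneSpectrum (𝓞 K), ((2 : ℕ) : 𝓞 K) ∈ w.asIdeal → ¬ 4 ∣ w.asIdeal.ramificationIdx ℤ)
    (L₁ : Type) [Field L₁] [NumberField L₁] [Algebra K L₁] (hL₁ : Module.finrank K L₁ = 2) (θ₁ : L₁) (hθ₁ : θ₁ ^ 2 = 2)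
    (L₂ : Type) [Field L₂] [NumberField L₂] [Algebra K L₂] (hL₂ : Module.finrank K L₂ = 4) (θ₂ : L₂) (hθ₂ : θ₂ ^ 4 - 4 * θ₂ ^ 2 + 2 = 0)
    (hr : (powMonoidHom (α := NarrowClassGroup L₂) 2).range.index = (powMonoidHom (α := NarrowClassGroup L₁) 2).range.index) :
    (∀ κ : ZpExtension K 2, κ.IsCyclotomic → ClassicalMuVanishes κ) ∧
    (∀ κ : ZpExtension K 2, κ.IsCyclotomic → ∀ m : ℕ, ∀ [NumberField (κ.layer m)],
      padicValNat 2 (narrowClassNumber (κ.layer m)) ≤ padicValNat 2 (classNumber (κ.layer m)) +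
        max (padicValNat 2 (powMonoidHom (α := NarrowClassGroup K) 2).range.index)
          (padicValNat 2 (powMonoidHom (α := NarrowClassGroup L₁) 2).range.index)) :=
  NarrowFukuda.narrowMu_of_layerTwo_model K hodd
    (fun κ hκ => totallyRamifiedFrom_one_of_forall_not_four_dvd_ramificationIdx
      (fun h => (Nat.not_even_iff_odd.mpr hodd) (even_iff_two_dvd.mpr h)) κ hκ h4)
    L₁ hL₁ θ₁ hθ₁ L₂ hL₂ θ₂ hθ₂ hr

/-- **«Narrow `μ₂ = 0`» OF A CUBIC FIELD FROM ONE EQUALITY OF NARROW `2`-RANKS, `rank₂ Cl⁺(K(√(2+√2))) = rank₂ Cl⁺(K(√2))` — NO OTHER HYPOTHESIS.**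
`K` a cubic number field (`[K:ℚ] = 3`: Fukuda's index is `≤ 1` for every cyclotomic `ℤ₂`-extension, §3); `L₁/K` quadratic with `θ₁² = 2`, `L₂/K` of degree
`4` with `θ₂⁴ − 4θ₂² + 2 = 0`; `[Cl⁺(L₂) : Cl⁺(L₂)²] = [Cl⁺(L₁) : Cl⁺(L₁)²]` ⟹ (a) `μ₂ = 0` for every cyclotomic `ℤ₂`-extension of `K` ∧ (b) bounded
narrow defect — the hypotheses `hμ`, `D`, `hδ` of the Kida-lite ascent.  (The rung `n = 0`, `rank₂ Cl⁺(K(√2)) = rank₂ Cl⁺(K)`, needs Fukuda index `0`,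
i.e. a ramification hypothesis; this rung needs none.) [cite: Fukuda1994, Thm. 1 (2), p. 264] [cite: Washington1997, §13.1] -/
theorem NarrowFukuda.narrowMu_of_layerTwo_model_of_finrank_eq_three (K : Type) [Field K] [NumberField K]
    (h3 : Module.finrank ℚ K = 3)
    (L₁ : Type) [Field L₁] [NumberField L₁] [Algebra K L₁] (hL₁ : Module.finrank K L₁ = 2) (θ₁ : L₁) (hθ₁ : θ₁ ^ 2 = 2)
    (L₂ : Type) [Field L₂] [NumberField L₂] [Algebra K L₂] (hL₂ : Module.finrank K L₂ = 4) (θ₂ : L₂) (hθ₂ : θ₂ ^ 4 - 4 * θ₂ ^ 2 + 2 = 0)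
    (hr : (powMonoidHom (α := NarrowClassGroup L₂) 2).range.index = (powMonoidHom (α := NarrowClassGroup L₁) 2).range.index) :
    (∀ κ : ZpExtension K 2, κ.IsCyclotomic → ClassicalMuVanishes κ) ∧
    (∀ κ : ZpExtension K 2, κ.IsCyclotomic → ∀ m : ℕ, ∀ [NumberField (κ.layer m)],
      padicValNat 2 (narrowClassNumber (κ.layer m)) ≤ padicValNat 2 (classNumber (κ.layer m)) +
        max (padicValNat 2 (powMonoidHom (α := NarrowClassGroup K) 2).range.index)
          (padicValNat 2 (powMonoidHom (α := NarrowClassGroup L₁) 2).range.index)) :=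
  NarrowFukuda.narrowMu_of_layerTwo_model K (by rw [h3]; decide)
    (forall_totallyRamifiedFrom_one_of_finrank_eq_three h3) L₁ hL₁ θ₁ hθ₁ L₂ hL₂ θ₂ hθ₂ hr

end Literature.NumberTheory.IwasawaTheory

end
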